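/-
Copyright (c) 2026 the pub-hodgecm-mathlib formalisation cell (harness21).  Prover seat hodgecm-mathlib-K2E4-p18 (g0),
Track B «K2-LIT» ∕ h413, unit «SingularProductFormula» (U2) of the line `K2_E4_SingularTransferKappaSign`, file #18 (helper half): the PLACE READINGS
behind the socket `K2E4SingularTransferKappaSign.SingularProductFormula.sig_K2E4KottwitzSignParity` (Kottwitz-sign parity at a rational semiregular `γ₀`).  2026-09-03.
-/
import Literature.NumberTheory.Rogawski1990.KottwitzSignProductFormula   -- ★ Kottwitz signs V–VII: `exists_diagonal_frame`, `isIsotropic_standingData_diagonal_iff`, `binary_anisotropic_iff_mul_pos`, `card_complexPlace_pos_eq_ncard_realPlace_pos`; ★ Liu2021 `LemD1BinaryIsotropyOfPlace`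
import HarnessLib

/-!
# K2_E4 road (h413 = stmt-HodgeConjecture-24833), unit «SingularProductFormula», file #18 — helper half:
# the `e₁`-eigenplane of a framed semiregular `γ₀`, read at the finite places of `L⁺` and at the infinite places of `L`

Cell `pub/hodgecm-mathlib` (D-0151), Track B (21-frontier RULING «PUSH BOTH» 2026-09-03, director req624, chair K2-lead), socket module
`Summits/HodgeConjecture/HodgeConjecture/Cruxes/H413/Lines/K2_E4_SingularTransferKappaSignSigsSingularProductFormula.lean`, socket #18 `sig_K2E4KottwitzSignParity`
(paid in the sequel `Theorems/K2E4KottwitzSignParity.lean`, which imports this file).  The socket counts the finite places `v` of `L⁺` NON-SPLIT in `L` at which the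
`e₁`-eigenplane `W₂(γ₀) = ker(γ₀ − e₁)` of a rational semiregular `γ₀ ∈ U(H′)(L⁺)` is anisotropic over `L ⊗_{L⁺} L⁺_v`, and the infinite places `w` of `L` at which it is
definite, in the «kernel» currency `∀ x, (γ₀ ⊗ 1 − e₁ ⊗ 1) x = 0 → Σᵢⱼ x̄ᵢ H′ᵢⱼ xⱼ = 0 → x = 0`.  This file reads that currency in the tree's DIAGONAL FRAME
(★ `exists_diagonal_frame`: `ᵗ(σP) H′ P = diag(d₀, d₁, d₂)`, `γ₀ P = P diag(a, a, b)`) as statements about the hermitian PLANE `⟨d₀, d₁⟩` over `L ∕ L⁺`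
[Rogawski1990, §3.8 Prop. 3.8.1 (a): `G′_{γ₀} ≅ U(W₂) × U(1)`; §4.1 (4.1.2): `e(γ′) = −1` iff `U(W₂)` anisotropic ∕ compact] [Landherr1936HermitianForms].

* §1 (any commutative ring `R`, ring endomorphism `τ`, frame `X·P = P·diag(a,a,b)`, `ᵗ(τP) H P = diag(t₀,t₁,t₂)`, `a − b` a unit):
  **`anisotropic_eigenvector_iff_binary_of_frame`** — «every `H`-isotropic `a`-eigenvector of `X` is `0`» ⟺ «the binary form `t₀ τ(u₀)u₀ + t₁ τ(u₁)u₁` is anisotropic»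
  (substitute `x = P y`: the eigen-equation reads `y₂ = 0`, the form reads `Σ tᵢ τ(yᵢ) yᵢ`, ★ `hermForm_congr`); `map_frame` pushes a frame along a ring map `φ` with `τ ∘ φ = φ ∘ σ`;
  `sum_sum_mul_eq_hermForm_map` (the socket's double sum is ★ `hermForm`).
* §2 (a field): `trace γ₀ = 2e₁ + e₂` from `charpoly γ₀ = (X − e₁)²(X − e₂)` (Mathlib `Matrix.trace_eq_neg_charpoly_nextCoeff`) and `trace γ₀ = 2a + b` from a frame (Mathlib
  `Matrix.trace_mul_cycle`), so **`frame_eq_of_charpoly_eq`**: the DOUBLE eigenvalue of ★ `exists_diagonal_frame` (`{a, b} = {e₁, e₂}`) IS `e₁` — the one place the socket's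
  characteristic-polynomial hypothesis is consumed (for an eigenLINE the parity fails); `det_ne_zero_of_anisotropic` (Mathlib `Matrix.exists_mulVec_eq_zero_iff`).
* §3 (the CM frame `ᵗ(σP) H′ P = diag(d)`, `γ₀ P = P diag(e₁, e₁, e₂)`, `σ dᵢ = dᵢ ≠ 0`):
  **`eigenplane_anisotropic_local_iff`** — at a finite place `v` of `L⁺`, «`v` non-split ∧ ANISO_v» ⟺ the hermitian plane `((L ⊗ L⁺_v)², diag(d₀, d₁) ⊗ 1)`
  (★ `Liu2021.LemD1OfPlace.standingData`) is NOT isotropic (§1 at `R = L ⊗_{L⁺} L⁺_v`, `τ = σ ⊗ 1`; split `v`: two places above `v` (★ `PlacesOver.galInv_ne`) and `(1_w, 0)` is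
  isotropic (★ `exists_conj_mul_self_eq_zero_of_smul_ne`); non-split `v`: ★ `PlacesOver.subsingleton_of_smul_eq`; the binary form is ★ `isIsotropic_standingData_diagonal_iff`);
  **`eigenplane_anisotropic_arch_iff`** — at an infinite place `w` of `L`, ANISO_w ⟺ `0 < Re σ_w(d₀ d₁)` (§1 at `R = ℂ`, `τ = conj`, `φ = σ_w`, which intertwines `σ` with `conj`
  on a CM field, Mathlib `IsCMField.complexEmbedding_complexConj`; ★ `binary_anisotropic_iff_mul_pos`);
  `ncard_setOf_embedding_pos_eq` — the places `w` of `L` with `0 < Re σ_w(t)` are equinumerous with the real places of `L⁺` with `0 < w(t)` (★ `card_complexPlace_pos_eq_ncard_realPlace_pos`).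

HONEST LABEL: HC_CM is proved only modulo the 7 printed citations (2 remaining named inputs: hLiu418 = stmt-HodgeConjecture-24832, h413 =
stmt-HodgeConjecture-24833) until rung 0 closes; this file is a `--supports stmt-HodgeConjecture-24833` helper and retires nothing by itself.

## References
* [Rogawski1990] J. D. Rogawski, *Automorphic Representations of Unitary Groups in Three Variables*, Ann. of Math. Stud. 123 (1990), §3.8 Prop. 3.8.1 p. 30; §4.1 (4.1.2)
  pp. 39–40; §8.1 p. 117; §8.2 p. 117 («`e(γ₀) = 1, e(γ₀′) = −1`»), Prop. 8.2.1 proof p. 119; §1.9 p. 11.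
* [Kottwitz1983] R. E. Kottwitz, *Sign changes in harmonic analysis on reductive groups*, Trans. AMS 278 (1983), 289–297, §1.
* [Landherr1936HermitianForms] W. Landherr, *Äquivalenz Hermitescher Formen über einem beliebigen algebraischen Zahlkörper*, Abh. Math. Sem. Hamburg 11 (1936) 245–248.
* [Omeara1963] O. T. O'Meara, *Introduction to Quadratic Forms* (1963), §63B, §71 Thm. 71:18.
-/

set_option autoImplicit false
-- the mandated namespace repeats the single-problem summit's segment (`HodgeConjecture.HodgeConjecture`)
set_option linter.dupNamespace false

noncomputable section

open NumberField IsDedekindDomain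
open Literature.NumberTheory.Rogawski1990 Literature.NumberTheory.Automorphic
open Literature.AlgebraicGeometry.ShimuraVarieties (unitaryGroup hermForm)
open scoped Matrix MatrixGroups

namespace Summit.HodgeConjecture.HodgeConjecture.Cruxes.H413.K2E4KottwitzSignParityReadings

/-! ## §1 Ring-generic: isotropic eigenvectors of a framed split-singular element -/

section Generic

variable {R : Type*} [CommRing R]

/-- The socket's double sum `Σᵢ Σⱼ τ(xᵢ) · φ(Mᵢⱼ) · xⱼ` is the tree's `hermForm τ (M ⊗_φ 1) x x`. [cite: Rogawski1990, §1.9 p. 11] -/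
theorem sum_sum_mul_eq_hermForm_map {S : Type*} [CommRing S] (φ : R →+* S) (τ : S →+* S) (M : Matrix (Fin 3) (Fin 3) R) (x : Fin 3 → S) :
    (∑ i, ∑ j, τ (x i) * φ (M i j) * x j) = hermForm τ (M.map φ) x x := by
  simp only [hermForm, dotProduct, Matrix.mulVec, Matrix.map_apply, Function.comp_apply, Finset.mul_sum, mul_assoc]

/-- **TRANSPORT THROUGH A DIAGONAL FRAME** (any commutative ring `R` with a ring endomorphism `τ`): if `X P = P · diag(a, a, b)` with `P ∈ GL₃(R)`, `a − b` a unit,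
and `ᵗ(τP) H P = diag(t₀, t₁, t₂)`, then «every `a`-eigenvector `x` of `X` with `⟨x, x⟩_H = 0` is `0`» iff «the binary form `t₀ τ(u₀)u₀ + t₁ τ(u₁)u₁` represents `0`
only trivially».  (Write `x = P y`: `(X − a) x = 0 ⟺ (b − a) y₂ = 0 ⟺ y₂ = 0`, and `⟨Py, Py⟩_H = Σ tᵢ τ(yᵢ) yᵢ`, ★ `hermForm_congr`.)  The eigenPLANE of a
split-singular element in its frame [Rogawski1990, §3.8 Prop. 3.8.1 (a)]. [cite: Rogawski1990, §3.8 Prop. 3.8.1 p. 30; §4.1 (4.1.2) p. 39] -/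
theorem anisotropic_eigenvector_iff_binary_of_frame (τ : R →+* R) (H X : Matrix (Fin 3) (Fin 3) R) (P : GL (Fin 3) R)
    {a b : R} (hab : IsUnit (a - b)) (t : Fin 3 → R)
    (hXP : X * (P : Matrix (Fin 3) (Fin 3) R) = (P : Matrix (Fin 3) (Fin 3) R) * Matrix.diagonal ![a, a, b])
    (hHP : ((P : Matrix (Fin 3) (Fin 3) R).map τ)ᵀ * H * (P : Matrix (Fin 3) (Fin 3) R) = Matrix.diagonal t) :
    (∀ x : Fin 3 → R, (X - a • (1 : Matrix (Fin 3) (Fin 3) R)) *ᵥ x = 0 → hermForm τ H x x = 0 → x = 0) ↔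
      ∀ u : Fin 2 → R, t 0 * (τ (u 0) * u 0) + t 1 * (τ (u 1) * u 1) = 0 → u = 0 := by
  set Pm : Matrix (Fin 3) (Fin 3) R := (P : Matrix (Fin 3) (Fin 3) R) with hPm
  set Pinv : Matrix (Fin 3) (Fin 3) R := ((P⁻¹ : GL (Fin 3) R) : Matrix (Fin 3) (Fin 3) R) with hPinv
  have hPiP : Pinv * Pm = 1 := by rw [hPinv, hPm, ← Units.val_mul, inv_mul_cancel, Units.val_one]
  have hPPi : Pm * Pinv = 1 := by rw [hPinv, hPm, ← Units.val_mul, mul_inv_cancel, Units.val_one]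
  have hba : IsUnit (b - a) := by rw [← neg_sub]; exact hab.neg
  -- the form in the frame
  have hform : ∀ y : Fin 3 → R, hermForm τ H (Pm *ᵥ y) (Pm *ᵥ y) =
      t 0 * (τ (y 0) * y 0) + t 1 * (τ (y 1) * y 1) + t 2 * (τ (y 2) * y 2) := by
    intro y
    rw [← hermForm_congr τ H Pm y y, hHP]
    simp only [hermForm, Matrix.mulVec_diagonal, dotProduct, Fin.sum_univ_three, Function.comp_apply]
    ring
  -- the eigen-equation in the frame
  have hmat : (X - a • (1 : Matrix (Fin 3) (Fin 3) R)) * Pm = Pm * Matrix.diagonal ![0, 0, b - a] := by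
    have h2 : Matrix.diagonal ![a, a, b] - a • (1 : Matrix (Fin 3) (Fin 3) R) = Matrix.diagonal ![0, 0, b - a] := by
      ext i j
      fin_cases i <;> fin_cases j <;> simp
    rw [Matrix.sub_mul, hXP, Matrix.smul_mul, Matrix.one_mul, ← h2, Matrix.mul_sub, Matrix.mul_smul, Matrix.mul_one]
  have heig : ∀ y : Fin 3 → R, (X - a • (1 : Matrix (Fin 3) (Fin 3) R)) *ᵥ (Pm *ᵥ y) = 0 ↔ y 2 = 0 := by
    intro y
    rw [Matrix.mulVec_mulVec, hmat, ← Matrix.mulVec_mulVec]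
    have hd : Matrix.diagonal ![0, 0, b - a] *ᵥ y = ![0, 0, (b - a) * y 2] := by
      ext i; fin_cases i <;> simp [Matrix.mulVec_diagonal]
    rw [hd]
    constructor
    · intro h
      have h3 : Pinv *ᵥ (Pm *ᵥ ![0, 0, (b - a) * y 2]) = 0 := by rw [h, Matrix.mulVec_zero]
      rw [Matrix.mulVec_mulVec, hPiP, Matrix.one_mulVec] at h3
      have h4 := congrFun h3 2
      simp only [Matrix.cons_val_two, Matrix.tail_cons, Matrix.head_cons, Pi.zero_apply] at h4
      exact (hba.mul_right_eq_zero).1 h4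
    · intro h
      rw [h, mul_zero]
      have : (![0, 0, 0] : Fin 3 → R) = 0 := by ext i; fin_cases i <;> rfl
      rw [this, Matrix.mulVec_zero]
  constructor
  · intro h u hu
    set y : Fin 3 → R := ![u 0, u 1, 0] with hy
    have hx : (X - a • (1 : Matrix (Fin 3) (Fin 3) R)) *ᵥ (Pm *ᵥ y) = 0 := (heig y).2 rfl
    have hf : hermForm τ H (Pm *ᵥ y) (Pm *ᵥ y) = 0 := by
      rw [hform]
      simp only [hy, Matrix.cons_val_zero, Matrix.cons_val_one, Matrix.cons_val_two, Matrix.tail_cons, Matrix.head_cons, map_zero,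
        mul_zero, add_zero]
      exact hu
    have h0 := h _ hx hf
    have hy0 : y = 0 := by
      have : Pinv *ᵥ (Pm *ᵥ y) = 0 := by rw [h0, Matrix.mulVec_zero]
      rwa [Matrix.mulVec_mulVec, hPiP, Matrix.one_mulVec] at this
    funext i
    fin_cases i
    · exact congrFun hy0 0
    · exact congrFun hy0 1
  · intro h x hx hf
    set y : Fin 3 → R := Pinv *ᵥ x with hy
    have hxy : x = Pm *ᵥ y := by rw [hy, Matrix.mulVec_mulVec, hPPi, Matrix.one_mulVec]
    rw [hxy] at hx hf
    have hy2 : y 2 = 0 := (heig y).1 hx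
    rw [hform, hy2, map_zero, zero_mul, mul_zero, add_zero] at hf
    have hu := h ![y 0, y 1] (by simpa using hf)
    have hy0 : y = 0 := by
      funext i
      fin_cases i
      · simpa using congrFun hu 0
      · simpa using congrFun hu 1
      · exact hy2
    rw [hxy, hy0, Matrix.mulVec_zero]

/-- **A frame travels along a ring map intertwining the involutions** (`τ ∘ φ = φ ∘ σ`): from `X P = P diag(a,a,b)` and `ᵗ(σP) H P = diag(d)` over `R` one gets
`(X ⊗ 1)(P ⊗ 1) = (P ⊗ 1) diag(φa, φa, φb)` and `ᵗ(τ(P ⊗ 1)) (H ⊗ 1) (P ⊗ 1) = diag(φ ∘ d)` over `S` — the shape in which the rational frame is read at a place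
(`φ = ι_v : L → L ⊗ L⁺_v`, resp. `φ = σ_w : L → ℂ`). [cite: Rogawski1990, §3.8 Prop. 3.8.1 p. 30] -/
theorem map_frame {S : Type*} [CommRing S] (φ : R →+* S) (σ : R →+* R) (τ : S →+* S) (hστ : ∀ x, τ (φ x) = φ (σ x))
    (H X : Matrix (Fin 3) (Fin 3) R) (P : GL (Fin 3) R) (a b : R) (d : Fin 3 → R)
    (hXP : X * (P : Matrix (Fin 3) (Fin 3) R) = (P : Matrix (Fin 3) (Fin 3) R) * Matrix.diagonal ![a, a, b])
    (hHP : ((P : Matrix (Fin 3) (Fin 3) R).map σ)ᵀ * H * (P : Matrix (Fin 3) (Fin 3) R) = Matrix.diagonal d) :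
    X.map φ * ((Matrix.GeneralLinearGroup.map φ P : GL (Fin 3) S) : Matrix (Fin 3) (Fin 3) S) =
        ((Matrix.GeneralLinearGroup.map φ P : GL (Fin 3) S) : Matrix (Fin 3) (Fin 3) S) * Matrix.diagonal ![φ a, φ a, φ b] ∧
      ((((Matrix.GeneralLinearGroup.map φ P : GL (Fin 3) S) : Matrix (Fin 3) (Fin 3) S)).map τ)ᵀ * H.map φ *
          ((Matrix.GeneralLinearGroup.map φ P : GL (Fin 3) S) : Matrix (Fin 3) (Fin 3) S) = Matrix.diagonal (fun i => φ (d i)) := by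
  have hPv : ((Matrix.GeneralLinearGroup.map φ P : GL (Fin 3) S) : Matrix (Fin 3) (Fin 3) S) = (P : Matrix (Fin 3) (Fin 3) R).map φ := rfl
  constructor
  · rw [hPv, ← Matrix.map_mul, hXP, Matrix.map_mul, Matrix.diagonal_map (map_zero φ)]
    congr 2
    funext i; fin_cases i <;> rfl
  · have hmapσ : ((P : Matrix (Fin 3) (Fin 3) R).map φ).map τ = (((P : Matrix (Fin 3) (Fin 3) R)).map σ).map φ := by
      rw [Matrix.map_map, Matrix.map_map]
      exact congrArg _ (funext fun x => hστ x)
    rw [hPv, hmapσ, ← Matrix.transpose_map, ← Matrix.map_mul, ← Matrix.map_mul, hHP, Matrix.diagonal_map (map_zero φ)]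

end Generic

/-! ## §2 Over a field: the trace pins the double eigenvalue; anisotropy gives non-degeneracy -/

section FieldLemmas

variable {K : Type*} [Field K]

/-- `charpoly g = (X − e₁)²(X − e₂) ⟹ trace g = 2e₁ + e₂` (Mathlib `Matrix.trace_eq_neg_charpoly_nextCoeff` and the `nextCoeff` of a product of monic linear factors).
[cite: Rogawski1990, §3.8 Prop. 3.8.1 p. 30] -/
theorem trace_eq_of_charpoly_eq (g : Matrix (Fin 3) (Fin 3) K) (e₁ e₂ : K)
    (h : g.charpoly = (Polynomial.X - Polynomial.C e₁) ^ 2 * (Polynomial.X - Polynomial.C e₂)) :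
    g.trace = e₁ + e₁ + e₂ := by
  rw [Matrix.trace_eq_neg_charpoly_nextCoeff, h, Polynomial.Monic.nextCoeff_mul ((Polynomial.monic_X_sub_C e₁).pow 2) (Polynomial.monic_X_sub_C e₂),
    Polynomial.Monic.nextCoeff_pow (Polynomial.monic_X_sub_C e₁), Polynomial.nextCoeff_X_sub_C, Polynomial.nextCoeff_X_sub_C]
  simp
  ring

/-- `g P = P diag(a, a, b)` with `P` invertible ⟹ `trace g = 2a + b` (`trace (P D P⁻¹) = trace D`, Mathlib `Matrix.trace_mul_cycle`).
[cite: Rogawski1990, §3.8 Prop. 3.8.1 p. 30] -/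
theorem trace_eq_of_frame (g : Matrix (Fin 3) (Fin 3) K) (P : GL (Fin 3) K) (a b : K)
    (hγP : g * (P : Matrix (Fin 3) (Fin 3) K) = (P : Matrix (Fin 3) (Fin 3) K) * Matrix.diagonal ![a, a, b]) :
    g.trace = a + a + b := by
  have hPPi : (P : Matrix (Fin 3) (Fin 3) K) * ((P⁻¹ : GL (Fin 3) K) : Matrix (Fin 3) (Fin 3) K) = 1 := by
    rw [← Units.val_mul, mul_inv_cancel, Units.val_one]
  have hPiP : ((P⁻¹ : GL (Fin 3) K) : Matrix (Fin 3) (Fin 3) K) * (P : Matrix (Fin 3) (Fin 3) K) = 1 := by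
    rw [← Units.val_mul, inv_mul_cancel, Units.val_one]
  have hg : g = (P : Matrix (Fin 3) (Fin 3) K) * Matrix.diagonal ![a, a, b] * ((P⁻¹ : GL (Fin 3) K) : Matrix (Fin 3) (Fin 3) K) := by
    rw [← hγP, Matrix.mul_assoc, hPPi, Matrix.mul_one]
  rw [hg, Matrix.trace_mul_cycle, hPiP, Matrix.one_mul, Matrix.trace_diagonal, Fin.sum_univ_three]
  simp

/-- **In the socket's frame the DOUBLE eigenvalue is `e₁`**: if `{a, b} = {e₁, e₂}`, `e₁ ≠ e₂`, `g P = P diag(a,a,b)` and `charpoly g = (X − e₁)²(X − e₂)`, then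
`a = e₁` and `b = e₂` (compare `trace g = 2a + b = 2e₁ + e₂`). [cite: Rogawski1990, §3.8 Prop. 3.8.1 p. 30] -/
theorem frame_eq_of_charpoly_eq (g : Matrix (Fin 3) (Fin 3) K) (P : GL (Fin 3) K) {a b e₁ e₂ : K} (hne : e₁ ≠ e₂)
    (hab : (a = e₁ ∧ b = e₂) ∨ (a = e₂ ∧ b = e₁))
    (hγP : g * (P : Matrix (Fin 3) (Fin 3) K) = (P : Matrix (Fin 3) (Fin 3) K) * Matrix.diagonal ![a, a, b])
    (h : g.charpoly = (Polynomial.X - Polynomial.C e₁) ^ 2 * (Polynomial.X - Polynomial.C e₂)) : a = e₁ ∧ b = e₂ := by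
  rcases hab with hab | ⟨hae, hbe⟩
  · exact hab
  · exfalso
    have h1 := trace_eq_of_charpoly_eq g e₁ e₂ h
    have h2 := trace_eq_of_frame g P a b hγP
    rw [hae, hbe] at h2
    exact hne (by linear_combination h1.symm.trans h2)

/-- An ANISOTROPIC form has non-degenerate Gram matrix: `(∀ x, ⟨x, x⟩_H = 0 → x = 0) ⟹ det H ≠ 0` (a kernel vector of `H` would be isotropic, Mathlib
`Matrix.exists_mulVec_eq_zero_iff`). [cite: Rogawski1990, §1.9 p. 11] -/
theorem det_ne_zero_of_anisotropic {n : Type*} [Fintype n] [DecidableEq n] (σ : K →+* K) (H : Matrix n n K)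
    (hanis : ∀ x : n → K, hermForm σ H x x = 0 → x = 0) : H.det ≠ 0 := by
  intro hdet
  obtain ⟨v, hv0, hv⟩ := Matrix.exists_mulVec_eq_zero_iff.2 hdet
  refine hv0 (hanis v ?_)
  simp only [hermForm, hv, dotProduct_zero]

end FieldLemmas

/-! ## §3 The CM frame, read at the places of `L⁺` and of `L` -/

section CM

variable {L : Type} [Field L] [NumberField L] [IsCMField L] {H' : Matrix (Fin 3) (Fin 3) L}

/-- **THE FINITE READING.**  In a diagonal frame `ᵗ(σP) H′ P = diag(d)`, `γ₀ P = P diag(e₁, e₁, e₂)` (`e₁ ≠ e₂`), at a finite place `v` of `L⁺`: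
«`v` is non-split in `L` AND every `H′`-isotropic `e₁`-eigenvector of `γ₀ ⊗ 1` over `L ⊗_{L⁺} L⁺_v` vanishes» iff the hermitian plane `((L ⊗ L⁺_v)², diag(d₀, d₁) ⊗ 1)`
(★ `Liu2021.LemD1OfPlace.standingData`) is NOT isotropic.  Non-split `v`: §1 at `R = L ⊗ L⁺_v`, `τ = σ ⊗ 1` and ★ `PlacesOver.subsingleton_of_smul_eq`;
split `v`: two places above `v` and the plane is isotropic on `(1_w, 0)` (★ `exists_conj_mul_self_eq_zero_of_smul_ne`).
[cite: Rogawski1990, §3.8 Prop. 3.8.1 (d) p. 30; §4.1 (4.1.2) p. 39] [cite: Landherr1936HermitianForms] -/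
theorem eigenplane_anisotropic_local_iff (v : HeightOneSpectrum (𝓞 ↥(maximalRealSubfield L))) (γ₀ : (UnitaryGroup.cmDatum L 3 H').Rational)
    {e₁ e₂ : L} (hne : e₁ ≠ e₂) {P : GL (Fin 3) L} {d : Fin 3 → L}
    (hP : (((P : Matrix (Fin 3) (Fin 3) L)).map (cmConjRingHom L))ᵀ * H' * (P : Matrix (Fin 3) (Fin 3) L) = Matrix.diagonal d)
    (hγP : (((γ₀ : unitaryGroup (cmConjRingHom L) H').val : GL (Fin 3) L) : Matrix (Fin 3) (Fin 3) L) * (P : Matrix (Fin 3) (Fin 3) L) =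
      (P : Matrix (Fin 3) (Fin 3) L) * Matrix.diagonal ![e₁, e₁, e₂])
    {δ : L} (hcδ : IsCMField.complexConj L δ = -δ) (hδ : δ ≠ 0)
    (hJh : ((Matrix.diagonal ![d 0, d 1]).map (IsCMField.complexConj L))ᵀ = Matrix.diagonal ![d 0, d 1])
    (hJdet : (Matrix.diagonal ![d 0, d 1]).det ≠ 0) :
    (Subsingleton (UnitaryGroup.PlacesOver L v) ∧
      (∀ x : Fin 3 → UnitaryGroup.LocalRing L v,
        Matrix.mulVec (((((γ₀ : unitaryGroup (cmConjRingHom L) H').val : GL (Fin 3) L) : Matrix (Fin 3) (Fin 3) L)).map (algebraMap L (UnitaryGroup.LocalRing L v)) -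
            algebraMap L (UnitaryGroup.LocalRing L v) e₁ • (1 : Matrix (Fin 3) (Fin 3) (UnitaryGroup.LocalRing L v))) x = 0 →
        (∑ i, ∑ j, UnitaryGroup.conjLocal L (IsCMField.complexConj L) v (x i) * algebraMap L (UnitaryGroup.LocalRing L v) (H' i j) * x j) = 0 →
        x = 0)) ↔
    ¬ Liu2021.LemD1.IsIsotropic
        (Liu2021.LemD1OfPlace.standingData L v (IsCMField.complexConj L) 2 (Matrix.diagonal ![d 0, d 1]) hcδ hδ le_rfl hJh hJdet) := by
  classical
  set ι := algebraMap L (UnitaryGroup.LocalRing L v) with hι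
  set τ := UnitaryGroup.conjLocal L (IsCMField.complexConj L) v with hτ
  obtain ⟨w⟩ : Nonempty (UnitaryGroup.PlacesOver L v) := inferInstance
  have hστ : ∀ x : L, τ (ι x) = ι (cmConjRingHom L x) := fun x => by
    rw [hτ, hι, cmConjRingHom_apply, UnitaryGroup.conjLocal_algebraMap]
  obtain ⟨hXP, hHP⟩ := map_frame ι (cmConjRingHom L) τ hστ H' _ P e₁ e₂ d hγP hP
  have hab : IsUnit (ι e₁ - ι e₂) := by rw [← map_sub]; exact (isUnit_iff_ne_zero.2 (sub_ne_zero.2 hne)).map ι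
  have hiff := anisotropic_eigenvector_iff_binary_of_frame τ (H'.map ι) _ (Matrix.GeneralLinearGroup.map ι P) hab (fun i => ι (d i)) hXP hHP
  simp only [sum_sum_mul_eq_hermForm_map]
  rw [isIsotropic_standingData_diagonal_iff]
  simp only [Matrix.cons_val_zero, Matrix.cons_val_one]
  by_cases hw : IsCMField.complexConj L • w.1 = w.1
  · -- NON-SPLIT
    have hsub := UnitaryGroup.PlacesOver.subsingleton_of_smul_eq (IsCMField.complexConj L) (IsCMField.complexConj_ne_one L) w hw
    constructor
    · rintro ⟨-, h⟩ ⟨u, hu0, hu⟩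
      exact hu0 (hiff.1 h u hu)
    · intro h
      refine ⟨hsub, hiff.2 fun u hu => ?_⟩
      by_contra hu0
      exact h ⟨u, hu0, hu⟩
  · -- SPLIT: both sides fail
    constructor
    · rintro ⟨hsub, -⟩
      exact absurd (Subsingleton.elim _ _) (UnitaryGroup.PlacesOver.galInv_ne (IsCMField.complexConj L) w hw)
    · intro h
      exfalso
      obtain ⟨ε, hε0, hε, -⟩ := exists_conj_mul_self_eq_zero_of_smul_ne v w hw
      apply h
      refine ⟨![ε, 0], ?_, ?_⟩
      · intro h0
        exact hε0 (by simpa using congrFun h0 0)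
      · simp only [Matrix.cons_val_zero, Matrix.cons_val_one, map_zero, mul_zero, add_zero]
        rw [← hτ, hε, mul_zero]

/-- **THE ARCHIMEDEAN READING.**  In the same frame (`σ dᵢ = dᵢ ≠ 0`), at an infinite place `w` of `L` with embedding `σ_w : L → ℂ` (which intertwines `σ` with complex
conjugation on the CM field `L`, Mathlib `IsCMField.complexEmbedding_complexConj`): «every `conj`-isotropic `σ_w(e₁)`-eigenvector of `σ_w(γ₀)` in `ℂ³` vanishes» iff
`0 < Re σ_w(d₀ d₁)` — the eigenplane is DEFINITE at `w` (§1 at `R = ℂ`; ★ `binary_anisotropic_iff_mul_pos`).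
[cite: Rogawski1990, §8.2 p. 117 («`e(γ₀′) = −1`» for the compact centraliser); §4.1 (4.1.2) p. 39] -/
theorem eigenplane_anisotropic_arch_iff (w : InfinitePlace L) (γ₀ : (UnitaryGroup.cmDatum L 3 H').Rational)
    {e₁ e₂ : L} (hne : e₁ ≠ e₂) {P : GL (Fin 3) L} {d : Fin 3 → L} (hd : ∀ i, cmConjRingHom L (d i) = d i) (hd0 : ∀ i, d i ≠ 0)
    (hP : (((P : Matrix (Fin 3) (Fin 3) L)).map (cmConjRingHom L))ᵀ * H' * (P : Matrix (Fin 3) (Fin 3) L) = Matrix.diagonal d)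
    (hγP : (((γ₀ : unitaryGroup (cmConjRingHom L) H').val : GL (Fin 3) L) : Matrix (Fin 3) (Fin 3) L) * (P : Matrix (Fin 3) (Fin 3) L) =
      (P : Matrix (Fin 3) (Fin 3) L) * Matrix.diagonal ![e₁, e₁, e₂]) :
    (∀ x : Fin 3 → ℂ,
        Matrix.mulVec (((((γ₀ : unitaryGroup (cmConjRingHom L) H').val : GL (Fin 3) L) : Matrix (Fin 3) (Fin 3) L)).map w.embedding - w.embedding e₁ • (1 : Matrix (Fin 3) (Fin 3) ℂ)) x = 0 →
        (∑ i, ∑ j, starRingEnd ℂ (x i) * w.embedding (H' i j) * x j) = 0 → x = 0) ↔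
      0 < (w.embedding (d 0 * d 1)).re := by
  set φ : L →+* ℂ := w.embedding with hφ
  have hστ : ∀ x : L, starRingEnd ℂ (φ x) = φ (cmConjRingHom L x) := fun x => by
    rw [cmConjRingHom_apply, IsCMField.complexEmbedding_complexConj]
  obtain ⟨hXP, hHP⟩ := map_frame φ (cmConjRingHom L) (starRingEnd ℂ) hστ H' _ P e₁ e₂ d hγP hP
  have hab : IsUnit (φ e₁ - φ e₂) := by rw [← map_sub]; exact (isUnit_iff_ne_zero.2 (sub_ne_zero.2 hne)).map φ
  have hiff := anisotropic_eigenvector_iff_binary_of_frame (starRingEnd ℂ) (H'.map φ) _ (Matrix.GeneralLinearGroup.map φ P) hab (fun i => φ (d i)) hXP hHP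
  have hreal : ∀ i, (φ (d i)).im = 0 := by
    intro i
    have h := IsCMField.complexEmbedding_complexConj L φ (d i)
    rw [← cmConjRingHom_apply, hd i] at h
    have him := congrArg Complex.im h
    rw [Complex.conj_im] at him
    linarith
  simp only [sum_sum_mul_eq_hermForm_map]
  rw [map_mul, ← binary_anisotropic_iff_mul_pos (hreal 0) (hreal 1) ((map_ne_zero_iff φ φ.injective).2 (hd0 0))
    ((map_ne_zero_iff φ φ.injective).2 (hd0 1))]
  exact hiff

open scoped Classical in
/-- Book-keeping: on a totally complex field a set of infinite places is counted on the subtype of complex places. [cite: Rogawski1990, §3.8 Prop. 3.8.1 (d) p. 30] -/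
theorem ncard_setOf_infinitePlace_eq_card_filter (p : InfinitePlace L → Prop) :
    {w : InfinitePlace L | p w}.ncard = (Finset.univ.filter (fun W : {w : InfinitePlace L // InfinitePlace.IsComplex w} => p W.1)).card := by
  rw [Set.ncard_eq_toFinset_card', Set.toFinset_setOf]
  refine (Finset.card_bij (fun W _ => W.1) ?_ ?_ ?_).symm
  · intro W hW
    simpa using hW
  · intro W₁ _ W₂ _ h
    exact Subtype.ext h
  · intro w hw
    exact ⟨⟨w, IsTotallyComplex.isComplex w⟩, by simpa using hw, rfl⟩

variable (L) in
open scoped Classical in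
/-- **The infinite places `w` of the CM field `L` with `0 < Re σ_w(t)` are equinumerous with the (real) places of `L⁺` at which `t > 0`** (`t ∈ L⁺`; ★
`card_complexPlace_pos_eq_ncard_realPlace_pos`: `w ↦ w|_{L⁺}` is a bijection, Mathlib `IsCMField.card_infinitePlace_eq_card_infinitePlace`).
[cite: Rogawski1990, §3.8 Prop. 3.8.1 (d) p. 30] -/
theorem ncard_setOf_embedding_pos_eq (t : maximalRealSubfield L) :
    {w : InfinitePlace L | 0 < (w.embedding (t : L)).re}.ncard =
      {w : InfinitePlace (maximalRealSubfield L) | ∃ hw : w.IsReal, 0 < InfinitePlace.embedding_of_isReal hw t}.ncard := by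
  rw [ncard_setOf_infinitePlace_eq_card_filter, card_complexPlace_pos_eq_ncard_realPlace_pos L t]

end CM

end Summit.HodgeConjecture.HodgeConjecture.Cruxes.H413.K2E4KottwitzSignParityReadings

end
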